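import Literature.AlgebraicGeometry.Resolution.LocalBlowup
import Literature.AlgebraicGeometry.Resolution.IntegralClosureEssFiniteType
import Mathlib.RingTheory.Localization.Integral
import Mathlib.RingTheory.Valuation.Integral
import Mathlib.RingTheory.Adjoin.FG
import HarnessLib

/-!
# Crux `Globalisation` (stmt-ResolutionOfSingularities-16486), line `birth_HomologicalConductor` — stub `stub_nrmStep`

Route `ResolutionOfSingularities/HomologicalConductor`, reshaped cut v2 ("lu-patching cut"), the
normalisation step of the tower-of-models induction: for a finitely generated `k`-subalgebra
`D ⊆ O` of `K = Frac D` (`O` a valuation ring of `K`) and an intermediate `k`-subalgebra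
`D ≤ C ⊆ D_{𝔪_O ∩ D}` (`locAtCentre D O`, LocalBlowup.lean), the elements of `K` integral over `C`
lie in `locAtCentre D' O` for the finitely generated model `D' = D[s] ⊆ O`, `s` a finite set of
`D`-module generators of the integral closure of `D` in `K` (finite by E. Noether,
`NoetherFiniteIntegralClosure_holds`, Liu 2002 Prop. 4.1.27), and `D'` consists of `C`-integral
elements.  The point is Stacks 0307: an element integral over the localisation `S⁻¹D ⊇ C` is
`(an element integral over D) / s` with `s ∈ S` (`IsIntegral.exists_multiple_integral_of_isLocalization`).
-/

-- single-problem summit: the doubled namespace component `ResolutionOfSingularities` is forced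
set_option linter.dupNamespace false

namespace Summit.ResolutionOfSingularities.ResolutionOfSingularities.Theorems.HomologicalConductorGlobalisation

open Literature.AlgebraicGeometry.Resolution

/-- Integrality over a subring of `K` passes to any larger coefficient ring inside `K`
(the structure maps being the inclusions). -/
private theorem isIntegral_of_comp_eq {K : Type} [Field K] {S T : Type} [CommRing S] [CommRing T]
    [Algebra S K] [Algebra T K] (φ : S →+* T) (h : (algebraMap T K).comp φ = algebraMap S K)
    {y : K} (hy : IsIntegral S y) : IsIntegral T y :=
  hy.map_of_comp_eq φ (RingHom.id K) (by rw [h, RingHom.id_comp])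

/-- A valuation ring `O` of `K` is integrally closed in `K`. -/
private theorem mem_of_isIntegral_valuationSubring {K : Type} [Field K] (O : ValuationSubring K)
    {y : K} (hy : IsIntegral O y) : y ∈ O := by
  have hv : O.valuation.Integers O :=
    { hom_inj := Subtype.coe_injective
      map_le_one := fun x => O.valuation_le_one x
      exists_of_le_one := fun r hr => ⟨⟨r, (O.valuation_le_one_iff r).mp hr⟩, rfl⟩ }
  exact (O.valuation_le_one_iff y).mp ((Valuation.mem_integer_iff _ _).mp (hv.mem_of_integral hy))

/-- **Normalisation of a chart stays the localisation of a finitely generated model.**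
For `D` a finitely generated `k`-subalgebra of `K = Frac D` inside the valuation ring `O` and
`D ≤ C ⊆ locAtCentre D O`, there is a finitely generated `D ≤ D' ⊆ O` consisting of `C`-integral
elements with `{y | y integral over C} ⊆ locAtCentre D' O`: take `D' = D[s]` for `s` a finite set
of `D`-module generators of the integral closure of `D` in `K` (E. Noether), so that `D'` IS that
integral closure; an element integral over `C ⊆ S⁻¹D` (`S` = elements of value `1`) has `m • y`
integral over `D` for some `m ∈ S` (Stacks 0307), whence `y = (m y)/m ∈ locAtCentre D' O`.
[cite: Liu2002, Prop. 4.1.27, p. 122] [cite: StacksProject, Tag 0307] -/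
theorem stub_nrmStep {k K : Type} [Field k] [Field K] [Algebra k K] (O : ValuationSubring K)
    (D : Subalgebra k K) (hD : D.FG) (hDK : IsFractionRing ↥D K) (hDO : D.toSubring ≤ O.toSubring)
    (C : Subalgebra k K) (hDC : D ≤ C)
    (hC : C.toSubring ≤ Literature.AlgebraicGeometry.Resolution.locAtCentre D.toSubring O) :
    ∃ D' : Subalgebra k K, D'.FG ∧ D ≤ D' ∧ D'.toSubring ≤ O.toSubring ∧
      (D' : Set K) ⊆ {y : K | IsIntegral ↥C y} ∧
      {y : K | IsIntegral ↥C y} ⊆ (Literature.AlgebraicGeometry.Resolution.locAtCentre D'.toSubring O : Set K) := by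
  classical
  -- E. Noether: the integral closure of `D` in `K` is a finite `D`-module
  haveI : Algebra.FiniteType k D := D.fg_iff_finiteType.mp hD
  haveI := hDK
  have hfin : Module.Finite D (integralClosure D K) :=
    NoetherFiniteIntegralClosure_holds.self k D K
  obtain ⟨g, hg⟩ := Module.finite_def.mp hfin
  obtain ⟨t, ht⟩ := hD
  -- the model `D' = k[t ∪ s] = D[s]`
  set s : Finset K := g.image (fun c : integralClosure D K => (c : K)) with hsdef
  set D' : Subalgebra k K := Algebra.adjoin k (↑(t ∪ s) : Set K) with hD'def
  have hDD' : D ≤ D' := by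
    rw [← ht, hD'def]
    exact Algebra.adjoin_mono (by exact_mod_cast Finset.subset_union_left)
  -- `D' ⊆` integral closure of `D`
  have hD'sub : ∀ y ∈ D', IsIntegral D y := by
    have hle : D' ≤ (integralClosure D K).restrictScalars k := by
      rw [hD'def, Algebra.adjoin_le_iff]
      intro y hy
      rw [Finset.coe_union, Set.mem_union, Finset.mem_coe, Finset.mem_coe] at hy
      change IsIntegral D y
      rcases hy with hy | hy
      · exact isIntegral_of_mem_subalgebra (A := k) D
          (ht ▸ Algebra.subset_adjoin (Finset.mem_coe.mpr hy))
      · obtain ⟨c, -, rfl⟩ := Finset.mem_image.mp hy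
        exact c.2
    exact fun y hy => hle hy
  -- integral closure of `D` `⊆ D'`
  have hD'sup : ∀ y : K, IsIntegral D y → y ∈ D' := by
    intro y hy
    have hmem : (⟨y, hy⟩ : integralClosure D K) ∈ Submodule.span D (g : Set (integralClosure D K)) := by
      rw [hg]; exact Submodule.mem_top
    suffices h : ∀ z ∈ Submodule.span D (g : Set (integralClosure D K)), (z : K) ∈ D' from
      h _ hmem
    intro z hz
    refine Submodule.span_induction (p := fun (z : integralClosure D K) _ => (z : K) ∈ D')
      ?_ ?_ ?_ ?_ hz
    · intro c hc
      apply Algebra.subset_adjoin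
      rw [Finset.coe_union, Set.mem_union, Finset.mem_coe, Finset.mem_coe]
      exact Or.inr (Finset.mem_image.mpr ⟨c, hc, rfl⟩)
    · exact zero_mem _
    · intro a b _ _ ha hb
      rw [Subalgebra.coe_add]
      exact add_mem ha hb
    · intro r a _ ha
      have : ((r • a : integralClosure D K) : K) = (r : K) * (a : K) := rfl
      rw [this]
      exact mul_mem (hDD' r.2) ha
  -- integrality over `D` passes to `C` and to `O`; over `C` it passes to `locAtCentre D O`
  have hDCint : ∀ y : K, IsIntegral D y → IsIntegral C y := fun y hy =>
    isIntegral_of_comp_eq (Subalgebra.inclusion hDC).toRingHom rfl hy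
  have hDOint : ∀ y : K, IsIntegral D y → IsIntegral O y := fun y hy =>
    isIntegral_of_comp_eq (Subring.inclusion hDO) rfl hy
  have hCLint : ∀ y : K, IsIntegral C y → IsIntegral (locAtCentre D.toSubring O) y := fun y hy =>
    isIntegral_of_comp_eq (S := C) (Subring.inclusion hC) rfl hy
  refine ⟨D', Subalgebra.fg_adjoin_finset _, hDD', ?_, ?_, ?_⟩
  · -- `D' ⊆ O`: `O` is integrally closed
    intro y hy
    exact mem_of_isIntegral_valuationSubring O (hDOint y (hD'sub y hy))
  · -- `D'` consists of `C`-integral elements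
    intro y hy
    exact hDCint y (hD'sub y hy)
  · -- `C`-integral elements lie in `locAtCentre D' O` (Stacks 0307)
    intro y hy
    have hy' : IsIntegral (locAtCentre D.toSubring O) y := hCLint y hy
    haveI := isLocalization_locAtCentre hDO
    obtain ⟨m, hm⟩ := IsIntegral.exists_multiple_integral_of_isLocalization
      (subringCentre D.toSubring O hDO).primeCompl y hy'
    have hvm : O.valuation ((m : D.toSubring) : K) = 1 :=
      valuation_eq_one_of_not_mem_subringCentre hDO m.2
    have hm' : IsIntegral D (((m : D.toSubring) : K) * y) := by
      have : (m • y : K) = ((m : D.toSubring) : K) * y := by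
        rw [Submonoid.smul_def, Algebra.smul_def]; rfl
      rw [← this]; exact hm
    have hmy : ((m : D.toSubring) : K) * y ∈ D' := hD'sup _ hm'
    have hmD' : ((m : D.toSubring) : K) ∈ D' := hDD' (m : D.toSubring).2
    show y ∈ locAtCentre D'.toSubring O
    rw [mem_locAtCentre_iff]
    refine ⟨_, hmy, _, hmD', hvm, ?_⟩
    exact (eq_div_iff (ne_zero_of_valuation_eq_one hvm)).mpr (mul_comm _ _)

end Summit.ResolutionOfSingularities.ResolutionOfSingularities.Theorems.HomologicalConductorGlobalisation
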